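import Summits.KontsevichZagierPeriods.KontsevichZagierPeriods.Theorems.LiouvilleUnfoldingAyoubPiLocalKernelRing
import Summits.KontsevichZagierPeriods.KontsevichZagierPeriods.Theorems.VietaFibreKernelFormMonotoneInvariants

/-!
# Item stmt-KontsevichZagierPeriods-0541, line `SketchIdeator2` (nilradical cut), stub `stub_nilLocalKernel`:
# the transcendence half holds at every monotone real point of `Spec P`

Support file (`--supports` stmt-KontsevichZagierPeriods-0541).  The transcendence half (N) of the nilradical
cut of item 0541 reads, on the prime spectrum of the formal period ring `P := KZ.FormalPeriodRing`
(`NilradicalCut.nilLocalKernel_iff_primes`): every prime ideal `q` of `P` with `⟦[π]⟧ ∉ q` contains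
`ker evalP` — every "integration theory" (ring map `θ : P →+* K` to a domain) in which the disc survives
kills every formal combination of value `0`.  This file settles the class of REAL MONOTONE theories
unconditionally, inside the calculus: a ring map `θ : P →+* ℝ` that is non-negative on the classes of
compact volume forms `∫_K 1` (`K` compact with non-empty interior) IS the evaluation
(`ringHom_eq_evalP_of_monotone`), by the rigidity of monotone move-invariant functionals
(`KernelForm.LocaliseAtValuePrime.exists_moveInvariant_eq_mul_eval`: Viu-Sos packing + rational boxes +
density, no transcendence input) and `θ 1 = 1`.  Hence its kernel is a prime avoiding `⟦[π]⟧` that contains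
— indeed equals — `ker evalP` (`ker_eq_ker_evalP_of_monotone`, `nilLocalKernel_at_monotone_primes`): the
positive real locus of `Spec P` is the single point `evalP`.  The additive version
(`ker_evalP_le_ker_of_monotone_additive`) needs no multiplicativity.  What remains open in (N) is exactly
the non-monotone (sign-changing or non-real) points.  References: M. Kontsevich, D. Zagier, *Periods*
(2001), §1.2; J. Ayoub, EMS Newsl. 91 (2014), Conj. 7; A. Huber, S. Müller-Stach, *Periods and Nori
Motives* (2017), Conj. 13.2.5.  No definition is introduced.
-/

noncomputable section

open Set
open Literature.NumberTheory.Transcendental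

namespace Summit.KontsevichZagierPeriods.LiouvilleUnfolding.NilradicalCut

open Summit.KontsevichZagierPeriods.LiouvilleUnfolding.PiLocalKernelPosition
open Summit.KontsevichZagierPeriods.KernelForm.LocaliseAtValuePrime

/-- An additive map out of `P` pulls back to a move-invariant functional on `FormalRep`. [folklore] -/
theorem comp_toFormalPeriod_mem_relations (θ : KZ.FormalPeriodRing →+ ℝ) :
    ∀ c ∈ KZ.relations, (θ.comp KZ.toFormalPeriod.toAddMonoidHom) c = 0 := by
  intro c hc
  rw [AddMonoidHom.comp_apply, NonUnitalRingHom.coe_toAddMonoidHom, KZ.toFormalPeriod_eq_zero_of_mem hc,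
    map_zero]

/-- **Rigidity of monotone additive functionals on `P`**: an additive `θ : P →+ ℝ` that is non-negative on
the classes of compact volume forms with non-empty interior is `θ ⟦[pt, 1]⟧ · evalP`. [folklore] -/
theorem additive_eq_mul_evalP_of_monotone (θ : KZ.FormalPeriodRing →+ ℝ)
    (hpos : ∀ (m : ℕ) (K : KZ.IntegralRep m), IsCompact K.domain → (interior K.domain).Nonempty →
      (∀ x ∈ K.domain, K.integrand x = 1) → 0 ≤ θ (KZ.toFormalPeriod (KZ.of K))) :
    ∀ x, θ x = θ 1 * KZ.evalP x := by
  obtain ⟨l, -, hl⟩ := exists_moveInvariant_eq_mul_eval (θ.comp KZ.toFormalPeriod.toAddMonoidHom)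
    (comp_toFormalPeriod_mem_relations θ) (fun m K hK hi h1 => hpos m K hK hi h1)
  have hl' : ∀ c, θ (KZ.toFormalPeriod c) = l * KZ.eval c := fun c => hl c
  have h1 : θ 1 = l := by
    rw [← KZ.toFormalPeriod_of_unit, hl', KZ.eval_of, KZ.IntegralRep.value_unit, mul_one]
  intro x
  obtain ⟨c, rfl⟩ := KZ.toFormalPeriod_surjective x
  rw [hl', h1, KZ.evalP_toFormalPeriod]

/-- **A monotone additive functional on `P` kills the value-kernel** (no multiplicativity needed).
[folklore] -/
theorem ker_evalP_le_ker_of_monotone_additive (θ : KZ.FormalPeriodRing →+ ℝ)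
    (hpos : ∀ (m : ℕ) (K : KZ.IntegralRep m), IsCompact K.domain → (interior K.domain).Nonempty →
      (∀ x ∈ K.domain, K.integrand x = 1) → 0 ≤ θ (KZ.toFormalPeriod (KZ.of K)))
    {x : KZ.FormalPeriodRing} (hx : KZ.evalP x = 0) : θ x = 0 := by
  rw [additive_eq_mul_evalP_of_monotone θ hpos, hx, mul_zero]

/-- **The positive real locus of `Spec P` is one point**: a ring map `θ : P →+* ℝ` that is non-negative on
the classes of compact volume forms with non-empty interior is the evaluation. [folklore] -/
theorem ringHom_eq_evalP_of_monotone (θ : KZ.FormalPeriodRing →+* ℝ)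
    (hpos : ∀ (m : ℕ) (K : KZ.IntegralRep m), IsCompact K.domain → (interior K.domain).Nonempty →
      (∀ x ∈ K.domain, K.integrand x = 1) → 0 ≤ θ (KZ.toFormalPeriod (KZ.of K))) :
    θ = KZ.evalP := by
  ext x
  have h := additive_eq_mul_evalP_of_monotone θ.toAddMonoidHom (fun m K hK hi h1 => hpos m K hK hi h1) x
  rwa [RingHom.toAddMonoidHom_eq_coe, AddMonoidHom.coe_coe, map_one, one_mul] at h

/-- The kernel of a monotone real integration theory is the value-kernel. [folklore] -/
theorem ker_eq_ker_evalP_of_monotone (θ : KZ.FormalPeriodRing →+* ℝ)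
    (hpos : ∀ (m : ℕ) (K : KZ.IntegralRep m), IsCompact K.domain → (interior K.domain).Nonempty →
      (∀ x ∈ K.domain, K.integrand x = 1) → 0 ≤ θ (KZ.toFormalPeriod (KZ.of K))) :
    RingHom.ker θ = RingHom.ker KZ.evalP := by
  rw [ringHom_eq_evalP_of_monotone θ hpos]

/-- **(N) at the monotone real primes, unconditionally.** For the kernel `q = ker θ` of a monotone real
integration theory: `q` is prime, the disc class is not in `q` (`θ ⟦[π]⟧ = π`), and `ker evalP ≤ q` — the
instance of `NilradicalCut.nilLocalKernel_iff_primes`'s right-hand side at every such `q`. [folklore] -/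
theorem nilLocalKernel_at_monotone_primes (θ : KZ.FormalPeriodRing →+* ℝ)
    (hpos : ∀ (m : ℕ) (K : KZ.IntegralRep m), IsCompact K.domain → (interior K.domain).Nonempty →
      (∀ x ∈ K.domain, K.integrand x = 1) → 0 ≤ θ (KZ.toFormalPeriod (KZ.of K))) :
    (RingHom.ker θ).IsPrime ∧ KZ.toFormalPeriod (KZ.of KZ.piRep) ∉ RingHom.ker θ ∧
      RingHom.ker KZ.evalP ≤ RingHom.ker θ := by
  refine ⟨RingHom.ker_isPrime θ, ?_, (ker_eq_ker_evalP_of_monotone θ hpos).ge⟩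
  rw [RingHom.mem_ker, ringHom_eq_evalP_of_monotone θ hpos]
  exact evalP_piClass_ne_zero

/-- **Registered sub-goal of the line** (`monotone_points_eq_evalP`): every monotone real integration
theory of the four-move calculus is the evaluation — the part of stub `stub_nilLocalKernel` (prime form)
that concerns monotone real primes. [folklore] -/
theorem monotone_points_eq_evalP : ∀ θ : KZ.FormalPeriodRing →+* ℝ, (∀ (m : ℕ) (K : KZ.IntegralRep m), IsCompact K.domain → (interior K.domain).Nonempty → (∀ x ∈ K.domain, K.integrand x = 1) → 0 ≤ θ (KZ.toFormalPeriod (KZ.of K))) → θ = KZ.evalP :=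
  fun θ h => ringHom_eq_evalP_of_monotone θ h

end Summit.KontsevichZagierPeriods.LiouvilleUnfolding.NilradicalCut

end
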